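import Summits.QuantumFields.YangMills.Theorems.LuscherReductionOneSiteLevelsMagPhaseDefs
import Summits.QuantumFields.YangMills.Theorems.LuscherReductionOneSiteLevelsPhase

/-!
# The magnetic phase `magPhase η`: measurability, gauge/twist invariance, link-Lipschitz constant `12π/η`, support, and the rate at `η = √λ_b`
# (support module for the VALLEY re-cut of `stub_absUpperOuter`, crux `OneSiteLevels`, route `LuscherReduction`, item stmt-QuantumFields-20007;
# fleet lead prover ym-luscher-20007-p1)

Discharges the (PHASE′) hypotheses of the OUTER seam `absUpperOuter_of_valley` (`Theorems/LuscherReductionOneSiteLevelsOuterSeam.lean`) for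
`Φ_B = magPhase (onePhaseScale B)`: `measurable_magPhase`, `magPhase_gaugeTransform`, `magPhase_twist`, `abs_magPhase_sub_le` (link-Lipschitz
`12π/η`, from `abs_wilsonAction_sub_le`), `magPhaseScale_lipschitzSq` (`(12π/√λ_b)² = 144π²/λ_b`), the support lemmas `lt_action_of_sin_magPhase_ne_zero`
(`sin Φ ≠ 0 ⇒ η < S`) / `action_lt_of_cos_magPhase_ne_zero` (`cos Φ ≠ 0 ⇒ S < 2η`), and the RATE lemma `exp_neg_mul_sqrt_bareLambda_le`:
for every `E′, C′` and `B ≥ 2/min(1, 2/(|E′|+|C′|+1))³`, `e^{−B√λ_b} ≤ e^{−E′λ_b + C′λ_b²}`.  So for this phase the VALLEY stub reduces to the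
single analytic statement about the `cos Φ_B · sin Θ_B`-piece (`OneSiteAbsUpperValley`, skeleton v8 draft).

## WHAT THIS IS NOT
No valley analysis; NOT the crux, NOT THE CLAY GAP.  Sorry-free; no named fact.
-/

set_option autoImplicit false

noncomputable section

open MeasureTheory Filter Topology Real
open scoped Matrix ComplexConjugate BigOperators
open Literature.MathematicalPhysics.QuantumFieldTheory
open Literature.MathematicalPhysics.QuantumLattice

namespace Summit.QuantumFields.YangMills.Theorems.FemtoTransferGap

/-- `0 ≤ Φ_η ≤ π/2`. [folklore] -/
theorem magPhase_mem (η : ℝ) (U : Cfg) : 0 ≤ magPhase η U ∧ magPhase η U ≤ Real.pi / 2 := by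
  unfold magPhase
  have h0 := clamp01_nonneg (wilsonAction su2Rep U / η - 1)
  have h1 := clamp01_le_one (wilsonAction su2Rep U / η - 1)
  have hpi : 0 < Real.pi / 2 := by positivity
  exact ⟨mul_nonneg hpi.le h0, by nlinarith⟩

/-- The magnetic phase is continuous, hence measurable. [folklore] -/
theorem measurable_magPhase (η : ℝ) : Measurable (magPhase η) := by
  haveI := secondCountableTopology_su2
  have hc : Continuous (magPhase η) := by
    unfold magPhase
    exact continuous_const.mul (continuous_clamp01.comp
      (((continuous_wilsonAction su2Rep (d := 3) (L := 1) continuous_su2Rep).div_const η).sub continuous_const))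
  exact hc.measurable

/-- Gauge invariance (the Wilson action is gauge invariant). [folklore] -/
theorem magPhase_gaugeTransform (η : ℝ) (g : Site 3 1 → SU2) (U : Cfg) : magPhase η (gaugeTransform g U) = magPhase η U := by
  unfold magPhase
  rw [wilsonAction_gaugeTransform]

/-- Twist invariance (`wilsonAction_twist`). [cite: tHooft1979] -/
theorem magPhase_twist (η : ℝ) (k : Fin 3) {z : SU2} (hz : z ∈ Subgroup.center SU2) (U : Cfg) :
    magPhase η (twist k z U) = magPhase η U := by
  unfold magPhase
  rw [wilsonAction_twist k hz]

/-- **Link-Lipschitz with constant `12π/η`** (`η > 0`): `|Φ_η(U) − Φ_η(V)| ≤ (12π/η) Σ_e ‖U_e − V_e‖_F`. [folklore] -/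
theorem abs_magPhase_sub_le {η : ℝ} (hη : 0 < η) (U V : Cfg) :
    |magPhase η U - magPhase η V|
      ≤ (12 * Real.pi / η) * ∑ e, frobNorm ((U e : Matrix (Fin 2) (Fin 2) ℂ) - (V e : Matrix (Fin 2) (Fin 2) ℂ)) := by
  unfold magPhase
  have hpi : 0 ≤ Real.pi / 2 := by positivity
  rw [← mul_sub, abs_mul, abs_of_nonneg hpi]
  have h1 := abs_clamp01_sub_le (wilsonAction su2Rep U / η - 1) (wilsonAction su2Rep V / η - 1)
  have h2 : |(wilsonAction su2Rep U / η - 1) - (wilsonAction su2Rep V / η - 1)|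
      = |wilsonAction su2Rep U - wilsonAction su2Rep V| / η := by
    rw [show (wilsonAction su2Rep U / η - 1) - (wilsonAction su2Rep V / η - 1)
      = (wilsonAction su2Rep U - wilsonAction su2Rep V) / η by ring, abs_div, abs_of_pos hη]
  have h3 := abs_wilsonAction_sub_le U V
  have hS : 0 ≤ ∑ e, frobNorm ((U e : Matrix (Fin 2) (Fin 2) ℂ) - (V e : Matrix (Fin 2) (Fin 2) ℂ)) :=
    Finset.sum_nonneg fun e _ => frobNorm_nonneg _
  calc Real.pi / 2 * |clamp01 (wilsonAction su2Rep U / η - 1) - clamp01 (wilsonAction su2Rep V / η - 1)|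
      ≤ Real.pi / 2 * (|wilsonAction su2Rep U - wilsonAction su2Rep V| / η) :=
        mul_le_mul_of_nonneg_left (h1.trans_eq h2) hpi
    _ ≤ Real.pi / 2 * ((24 * ∑ e, frobNorm ((U e : Matrix (Fin 2) (Fin 2) ℂ) - (V e : Matrix (Fin 2) (Fin 2) ℂ))) / η) :=
        mul_le_mul_of_nonneg_left (div_le_div_of_nonneg_right h3 hη.le) hpi
    _ = (12 * Real.pi / η) * ∑ e, frobNorm ((U e : Matrix (Fin 2) (Fin 2) ℂ) - (V e : Matrix (Fin 2) (Fin 2) ℂ)) := by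
        field_simp
        ring

/-- Support of the `sin`-piece: `sin Φ_η(U) ≠ 0 ⇒ η < S(U)` (`η > 0`). [folklore] -/
theorem lt_action_of_sin_magPhase_ne_zero {η : ℝ} (hη : 0 < η) {U : Cfg} (h : Real.sin (magPhase η U) ≠ 0) :
    η < wilsonAction su2Rep U := by
  have hne : clamp01 (wilsonAction su2Rep U / η - 1) ≠ 0 := by
    intro h0
    apply h
    unfold magPhase
    rw [h0, mul_zero, Real.sin_zero]
  have hpos := pos_of_clamp01_ne_zero hne
  have : 1 < wilsonAction su2Rep U / η := by linarith
  rwa [lt_div_iff₀ hη, one_mul] at this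

/-- Support of the `cos`-piece: `cos Φ_η(U) ≠ 0 ⇒ S(U) < 2η` (`η > 0`). [folklore] -/
theorem action_lt_of_cos_magPhase_ne_zero {η : ℝ} (hη : 0 < η) {U : Cfg} (h : Real.cos (magPhase η U) ≠ 0) :
    wilsonAction su2Rep U < 2 * η := by
  by_contra hge
  push Not at hge
  apply h
  unfold magPhase
  have h1 : 1 ≤ wilsonAction su2Rep U / η - 1 := by
    rw [le_sub_iff_add_le, le_div_iff₀ hη]
    linarith
  rw [clamp01_of_one_le h1, mul_one, Real.cos_pi_div_two]

/-- Squared Lipschitz constant at the threshold `η = √λ_b`: `(12π/√λ_b)² ≤ 144π²/λ_b` (in fact `=`). [folklore] -/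
theorem magPhaseScale_lipschitzSq {B : ℝ} (hB : 0 < B) :
    (12 * Real.pi / onePhaseScale B) ^ 2 ≤ (144 * Real.pi ^ 2) / bareLambda B := by
  rw [div_pow, onePhaseScale_sq hB]
  apply le_of_eq
  ring

/-- **Rate at the threshold `η_B = √λ_b`**: for every `E′, C′`, once `λ_b ≤ min 1 (2/(|E′| + |C′| + 1))` (i.e. `B` large),
`e^{−B√λ_b} ≤ e^{−E′λ_b + C′λ_b²}` — large fields are below any semiclassical rate. [cite: Luscher1983, §2] -/
theorem exp_neg_mul_sqrt_bareLambda_le {B E' C' : ℝ} (hB : 0 < B) (hl1 : bareLambda B ≤ 1)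
    (hl2 : bareLambda B ≤ 2 / (|E'| + |C'| + 1)) :
    Real.exp (-(B * onePhaseScale B)) ≤ Real.exp (-(E' * bareLambda B) + C' * bareLambda B ^ 2) := by
  apply Real.exp_le_exp.mpr
  set x := bareLambda B with hx
  have hx0 : 0 < x := by rw [hx]; unfold bareLambda; exact Real.rpow_pos_of_pos (by positivity) _
  have hcube : B * x ^ 3 = 2 := bareLambda_cube hB
  have hsq : onePhaseScale B ^ 2 = x := onePhaseScale_sq hB
  have hs0 : 0 < onePhaseScale B := onePhaseScale_pos hB
  -- `√x ≥ x ≥ x²` on `[0,1]`, hence `B√x ≥ B x² · x / x = 2/x ≥ (|E′|+|C′|) x`… we use `B √x · x² ≥ B x³ = 2`.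
  have h1 : x ^ 2 ≤ onePhaseScale B := by
    -- `x² ≤ x ≤ √x` since `x ≤ 1` and `(√x)² = x`
    nlinarith [hsq, hs0, hx0, hl1, sq_nonneg (onePhaseScale B - x), sq_nonneg (onePhaseScale B - 1)]
  have hM : 0 < |E'| + |C'| + 1 := by positivity
  -- `(|E′| + |C′|) x² ≤ (|E′|+|C′|+1)·x·x ≤ 2x`… precisely `(|E'|+|C'|) * x ≤ 2 / x`
  have h2 : (|E'| + |C'|) * x ^ 2 ≤ 2 := by
    have : x * (|E'| + |C'| + 1) ≤ 2 := by
      have := (le_div_iff₀ hM).mp hl2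
      linarith
    nlinarith [hx0, hl1, abs_nonneg E', abs_nonneg C']
  -- `B · √x ≥ B x² ≥ …`: from `x² ≤ √x`, `B √x ≥ B x²` and `B x² · x = 2`
  have h3 : 2 / x ≤ B * onePhaseScale B := by
    rw [div_le_iff₀ hx0]
    have : B * x ^ 2 ≤ B * onePhaseScale B := mul_le_mul_of_nonneg_left h1 hB.le
    nlinarith [hcube, this, hs0]
  have h4 : (|E'| + |C'|) * x ≤ 2 / x := by
    rw [le_div_iff₀ hx0]
    nlinarith [h2]
  have h5 : -(E' * x) + C' * x ^ 2 ≥ -((|E'| + |C'|) * x) := by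
    have hx1 : x ^ 2 ≤ x := by nlinarith
    nlinarith [le_abs_self E', neg_abs_le C', abs_nonneg C', hx0, hx1]
  linarith

end Summit.QuantumFields.YangMills.Theorems.FemtoTransferGap

end
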